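import Summits.NavierStokesRegularity.NavierStokesRegularity.Theses.SymmetryModuliCount
import Literature.Analysis.FluidPDE.TypeIAncientMild
import Literature.Analysis.FluidPDE.KNSSTypeIRateLiouvilleHolds

/-!
# Sketch — crux `HelicalEndLiouville` (stmt-NavierStokesRegularity-14062), ideator 1, round 1

First lemmas of the two idea cards of this seat, typed over tree declarations (no proofs asked
except the pure-logic glue theorems, which certify that each card's decomposition concludes the
crux BY NAME):

* card `period-gap-slaving` — `PeriodicFarEndFlattening` (+ bricks `PeriodicZeroMeanHeatDamping`,
  `FluctuationDuhamel`), `FlatEndLiouville`; glue `helicalEndLiouville_of_flattening`.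
* card `columnar-mean-gap` — `HelicalMeanIsColumnar`, `HelicalAmplitudeIsSubTypeI`,
  `KatoGapOnEnd`, `TranslationEndLiouville`; glue `helicalEndLiouville_of_subTypeI`.

Shared S–M step of every line: `HelicalOrTranslationIsPeriodic` (a screw of nonzero pitch
contains the translation by one pitch; sibling file Cruxes/ForcedSymmetry/Ideator2Sketch.lean).
-/

noncomputable section

set_option linter.dupNamespace false

namespace Summit.NavierStokesRegularity.NavierStokesRegularity.Cruxes.HelicalEndLiouville.Ideator1

open Literature.Analysis.FluidPDE MeasureTheory Set Function Filter Topology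
open scoped RealInnerProductSpace

/-- `ℝ³` as in the route file. -/
abbrev E3 : Type := EuclideanSpace ℝ (Fin 3)

/-! ## The crux and the route support item, verbatim

(The farm's copy of `Theses/SymmetryModuliCount.lean` predates rev 5 and does not yet export
`HelicalEndLiouville` / `BackwardEndVanishing` — cf. the refuter's stamp note on stmt-14062,
"stale farm route module only" — so the two decls are restated here VERBATIM from the route file;
the glue theorems below therefore conclude the crux's literal statement.) -/

/-- VERBATIM copy of `Summit.NavierStokesRegularity.NavierStokesRegularity.Theses.SymmetryModuliCount.HelicalEndLiouville`
(item stmt-NavierStokesRegularity-14062, the crux). -/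
def HelicalEndLiouville : Prop :=
  ∀ (C : ℝ) (u : ℝ → EuclideanSpace ℝ (Fin 3) → EuclideanSpace ℝ (Fin 3)), Literature.Analysis.FluidPDE.IsTypeIAncientMild C u → ∀ (a : EuclideanSpace ℝ (Fin 3)) (A : EuclideanSpace ℝ (Fin 3) →L[ℝ] EuclideanSpace ℝ (Fin 3)) (θ : ℝ), (∀ x, inner ℝ (A x) x = 0) → a ∉ Set.range A → θ ≤ 0 → (∀ t < θ, ∀ x, fderiv ℝ (u t) x (a + A x) - A (u t x) = 0) → ∀ t < θ, ∀ x, u t x = 0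

/-- VERBATIM copy of `…Theses.SymmetryModuliCount.BackwardEndVanishing` (route support item
stmt-NavierStokesRegularity-14064: vanishing on a backward end propagates forward). -/
def BackwardEndVanishing : Prop :=
  ∀ (C : ℝ) (u : ℝ → EuclideanSpace ℝ (Fin 3) → EuclideanSpace ℝ (Fin 3)), Literature.Analysis.FluidPDE.IsTypeIAncientMild C u → ∀ θ : ℝ, θ ≤ 0 → (∀ t < θ, ∀ x, u t x = 0) → ∀ t < 0, ∀ x, u t x = 0

/-! ## Averaging along the period -/

/-- Average of a field over one period `L`: `(lineAvg L f)(x) = ∫₀¹ f(x + hL) dh`. For an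
`L`-periodic continuous `f` this is invariant under every translation along `L` and commutes with
translations, with the heat flow and with the Oseen–Duhamel operator (Fubini). -/
def lineAvg (L : E3) (f : E3 → E3) (x : E3) : E3 :=
  ∫ h in (0 : ℝ)..1, f (x + h • L)

/-- The fluctuation (zero-mean part along the period): `f − lineAvg L f`. -/
def fluct (L : E3) (f : E3 → E3) (x : E3) : E3 :=
  f x - lineAvg L f x

/-! ## Shared step: screw ⊃ lattice -/

/-- **Helical-or-translation ⇒ periodic** (screw calculus, S–M; same statement as the sibling
`Cruxes/ForcedSymmetry/Ideator2Sketch.HelicalOrTranslationIsPeriodic`, written with the crux's own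
generator): `∇u·(a + Ax) = Au` on `t < θ` with `A` skew and `a ∉ range A` integrates to
`u(t, Φ_s x) = e^{sA} u(t, x)` along the screw flow, and one full turn `s = 2π/ρ` (`s = 1` if
`A = 0`) is the translation by `L = (2π/ρ)·P_{ker A} a ≠ 0` (`L = a` if `A = 0`). -/
def HelicalOrTranslationIsPeriodic : Prop :=
  ∀ (C : ℝ) (u : ℝ → E3 → E3), IsTypeIAncientMild C u →
    ∀ (a : E3) (A : E3 →L[ℝ] E3) (θ : ℝ), (∀ x, ⟪A x, x⟫ = 0) → a ∉ Set.range A → θ ≤ 0 →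
      (∀ t < θ, ∀ x, fderiv ℝ (u t) x (a + A x) - A (u t x) = 0) →
        ∃ L : E3, L ≠ 0 ∧ ∀ t < θ, ∀ x, u t (x + L) = u t x

/-! ## Card `period-gap-slaving` -/

/-- **FIRST LEMMA of card `period-gap-slaving` — far-end flattening of periodic elements.**
There is a universal `κ₀ > 0` such that every `u ∈ A_C` which is `L`-periodic on a backward end
`t < θ` is EXACTLY invariant under all translations along `L` on the far end
`t < min θ (−(κ₀ C ‖L‖)²)`. (The zero-mean part `u′ = u − lineAvg L u` obeys, from `t = −∞`, a
SOURCE-FREE linear Volterra inequality `φ(t) ≤ 6c₂C ∫_{−∞}^t (t−τ)^{−1/2} e^{−(2π/‖L‖)²(t−τ)/2}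
(−τ)^{−1/2} φ(τ) dτ`, `φ = ‖u′(t)‖_∞`, because the heat flow damps zero-mean periodic data at the
rate `e^{−(2π/‖L‖)² s}`, the Oseen operator commutes with `lineAvg`, and the mean flow cannot
force the fluctuation: `(I − lineAvg)(ū ⊗ ū) = 0`; taking `sup_{τ ≤ t}` absorbs:
`Φ(t) ≤ κ₀ C ‖L‖ (−t)^{−1/2} Φ(t)`, so `Φ(t) = 0` once `−t > (κ₀C‖L‖)²`.) -/
def PeriodicFarEndFlattening : Prop :=
  ∃ κ₀ : ℝ, 0 < κ₀ ∧ ∀ (C : ℝ) (u : ℝ → E3 → E3), IsTypeIAncientMild C u →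
    ∀ (L : E3) (θ : ℝ), L ≠ 0 → θ ≤ 0 → (∀ t < θ, ∀ x, u t (x + L) = u t x) →
      ∀ t < θ, t < -(κ₀ * C * ‖L‖) ^ 2 → ∀ (x : E3) (h : ℝ), u t (x + h • L) = u t x

/-- Brick 1 (elementary, S): **the heat flow damps zero-mean periodic data exponentially in sup
norm**: for a bounded continuous `L`-periodic `g` with `lineAvg L g = 0`,
`‖e^{sΔ} g‖_∞ ≤ 4 e^{−(2π/‖L‖)² s} ‖g‖_∞` (product structure of the Gaussian, the periodised 1-D
heat kernel minus its mean has `L¹`-mass `≤ Σ_{k≠0} e^{−k²μ²s} ≤ 4e^{−μ²s} ∧ 2`). -/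
def PeriodicZeroMeanHeatDamping : Prop :=
  ∀ (L : E3) (g : E3 → E3) (M : ℝ), L ≠ 0 → Continuous g → (∀ x, ‖g x‖ ≤ M) →
    (∀ x, g (x + L) = g x) → (∀ x, lineAvg L g x = 0) →
      ∀ s : ℝ, 0 < s → ∀ x,
        ‖Literature.Analysis.UnboundedOperators.heatExtension g s x‖ ≤
          4 * Real.exp (-((2 * Real.pi / ‖L‖) ^ 2 * s)) * M

/-- Brick 2 (S–M): **the fluctuation's Duhamel identity from `t = −∞`** — apply `I − lineAvg L` to
the Oseen identity of `u ∈ A_C` between `s < t` and let `s → −∞` (the free term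
`e^{(t−s)Δ}u′(s)` is bounded by `2C/√(−s) → 0`; the Duhamel integrals converge absolutely by the
Type-I bound): with `ū = lineAvg L u`, `u′ = u − ū`,
`u′(t) = −lim_{s→−∞} [B_s(ū,u′) + B_s(u′,ū) + (I − lineAvg L) B_s(u′,u′)](t)` — no `B_s(ū,ū)`
term, since the mean cannot force the fluctuation. -/
def FluctuationDuhamel : Prop :=
  ∀ (C : ℝ) (u : ℝ → E3 → E3), IsTypeIAncientMild C u →
    ∀ (L : E3) (θ : ℝ), L ≠ 0 → θ ≤ 0 → (∀ t < θ, ∀ x, u t (x + L) = u t x) →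
      ∀ t < θ, ∀ x,
        Tendsto (fun s : ℝ =>
            oseenDuhamel 1 s (fun τ => lineAvg L (u τ)) (fun τ => fluct L (u τ)) t x
              + oseenDuhamel 1 s (fun τ => fluct L (u τ)) (fun τ => lineAvg L (u τ)) t x
              + fluct L (oseenDuhamel 1 s (fun τ => fluct L (u τ)) (fun τ => fluct L (u τ)) t) x)
          atBot (𝓝 (-(fluct L (u t) x)))

/-- **Flat end ⇒ zero** (the tree THEOREM `KNSS2009_typeI_rate_liouville_holds` up to a rotation
taking `L` to `e₂`, the time shift `u(· + θ')` that makes the field bounded, `IsDivFree ⇒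
IsWeaklyDivFree` and `heatFlow = heatExtension`; S–M glue, rotation covariance of the Oseen class
being the one lemma to write): an element of `A_C` invariant under all translations along a line
on a backward end vanishes on that end. For a genuinely helical `u` (`A ≠ 0`) even Theorem 5.1 is
unnecessary: flat + screw-invariant = columnar, whose dynamics is the heat equation
(`heat_liouville_ancient`). -/
def FlatEndLiouville : Prop :=
  ∀ (C : ℝ) (u : ℝ → E3 → E3), IsTypeIAncientMild C u →
    ∀ (L : E3) (θ : ℝ), L ≠ 0 → θ ≤ 0 → (∀ t < θ, ∀ (x : E3) (h : ℝ), u t (x + h • L) = u t x) →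
      ∀ t < θ, ∀ x, u t x = 0

/-- **Glue of card `period-gap-slaving` (proved, pure logic)**: screw ⊃ lattice, far-end
flattening, the flat-end Liouville theorem and forward uniqueness (`BackwardEndVanishing`, route
support item stmt-14064) conclude the crux `HelicalEndLiouville` by name. -/
theorem helicalEndLiouville_of_flattening (hH : HelicalOrTranslationIsPeriodic)
    (hF : PeriodicFarEndFlattening) (hL : FlatEndLiouville) (hB : BackwardEndVanishing) :
    HelicalEndLiouville := by
  intro C u hu a A θ hA ha hθ hsym t ht x
  obtain ⟨L, hL0, hper⟩ := hH C u hu a A θ hA ha hθ hsym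
  obtain ⟨κ₀, -, hflat⟩ := hF
  set θ' : ℝ := min θ (-(κ₀ * C * ‖L‖) ^ 2 - 1) with hθ'def
  have hθ'θ : θ' ≤ θ := min_le_left _ _
  have hθ'0 : θ' ≤ 0 := hθ'θ.trans hθ
  have hθ'T : θ' ≤ -(κ₀ * C * ‖L‖) ^ 2 - 1 := min_le_right _ _
  have flat : ∀ s < θ', ∀ (y : E3) (h : ℝ), u s (y + h • L) = u s y := by
    intro s hs y h
    exact hflat C u hu L θ hL0 hθ hper s (lt_of_lt_of_le hs hθ'θ) (by linarith) y h
  have hz : ∀ s < θ', ∀ y, u s y = 0 := hL C u hu L θ' hL0 hθ'0 flat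
  exact hB C u hu θ' hθ'0 hz t (lt_of_lt_of_le ht hθ) x

/-! ## Card `columnar-mean-gap` -/

/-- **FIRST LEMMA of card `columnar-mean-gap` — the period-mean of a helical field is columnar.**
If `u ∈ A_C` is annihilated on `t < θ` by the screw generator `(a, A)` with `A ≠ 0`,
`a ∉ range A`, and `L` is the pitch vector (one full turn), then `ū = lineAvg L u` is invariant
under translations along `L` AND under the rotations `e^{sA}` about the screw axis (through the
point `c` with `A c = −P_{range A} a`): the `z`-average over one period of a screw-invariant field
is the azimuthal average of a slice (sympy-checked, kit job j010960 CHECK C). With `div ū = 0`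
this makes `ū` columnar: `ū = ū_φ(t,r) e_φ + ū_z(t,r) e_z`. -/
def HelicalMeanIsColumnar : Prop :=
  ∀ (C : ℝ) (u : ℝ → E3 → E3), IsTypeIAncientMild C u →
    ∀ (a : E3) (A : E3 →L[ℝ] E3) (θ : ℝ), (∀ x, ⟪A x, x⟫ = 0) → A ≠ 0 → a ∉ Set.range A → θ ≤ 0 →
      (∀ t < θ, ∀ x, fderiv ℝ (u t) x (a + A x) - A (u t x) = 0) →
        ∃ (L c : E3), L ≠ 0 ∧ A L = 0 ∧ a - A c = (⟪a, L⟫ / ‖L‖ ^ 2) • L ∧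
          (∀ t < θ, ∀ x, u t (x + L) = u t x) ∧
          (∀ t < θ, ∀ (x : E3) (h : ℝ), lineAvg L (u t) (x + h • L) = lineAvg L (u t) x) ∧
          (∀ t < θ, ∀ x, fderiv ℝ (lineAvg L (u t)) x (A (x - c)) - A (lineAvg L (u t) x) = 0)

/-- **Helical elements are sub-Type-I at `t = −∞`** (M): for `u ∈ A_C` helical on `t < θ`
(`A ≠ 0`, nonzero pitch), `√(−t) ‖u(t)‖_∞ → 0` as `t → −∞`, quantitatively
`‖u(t)‖_∞ ≤ K₁C²‖L‖/(−t) + K₂C⁴‖L‖²/(−t)^{3/2}`: the fluctuation is slaved,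
`‖u − ū‖_∞ ≤ K₁ C² ‖L‖/(−t)` (Brick 1 + the Oseen bound, NO absorption), and the columnar mean
solves the LINEAR Stokes/heat flow (its self-interaction `(ū·∇)ū = −(ū_φ²/r)e_r` is a radial
gradient, killed by the Leray projector) forced only by the Reynolds stress `lineAvg(u′ ⊗ u′) =
O(‖L‖²C⁴/t²)`, whence `‖ū(t)‖_∞ ≲ ∫_{−∞}^t (t−τ)^{−1/2} ‖L‖²C⁴ τ^{−2} dτ = (π/2)‖L‖²C⁴(−t)^{−3/2}`. -/
def HelicalAmplitudeIsSubTypeI : Prop :=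
  ∀ (C : ℝ) (u : ℝ → E3 → E3), IsTypeIAncientMild C u →
    ∀ (a : E3) (A : E3 →L[ℝ] E3) (θ : ℝ), (∀ x, ⟪A x, x⟫ = 0) → A ≠ 0 → a ∉ Set.range A → θ ≤ 0 →
      (∀ t < θ, ∀ x, fderiv ℝ (u t) x (a + A x) - A (u t x) = 0) →
        ∀ ε > 0, ∃ θ' ≤ θ, ∀ t < θ', ∀ x, Real.sqrt (-t) * ‖u t x‖ ≤ ε

/-- **Kato gap on a backward end** (S–M, the route's "Kato gap", here localised to an end): there
is a universal `ε₀ > 0` (= `1/(π c_O)`, `c_O` the `L¹` constant of the Oseen kernel) such that an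
element of `A_C` with `√(−t)‖u(t)‖_∞ ≤ ε₀` on an end `t < θ` vanishes there: from `t = −∞` the mild
identity reads `u(t) = −∫_{−∞}^t e^{(t−τ)Δ}P∇·(u⊗u)`, so `f(t) := sup_{τ≤t} √(−τ)‖u(τ)‖_∞` obeys
`f ≤ π c_O f²`, i.e. `f = 0` or `f ≥ ε₀`. -/
def KatoGapOnEnd : Prop :=
  ∃ ε₀ : ℝ, 0 < ε₀ ∧ ∀ (C : ℝ) (u : ℝ → E3 → E3), IsTypeIAncientMild C u →
    ∀ θ : ℝ, θ ≤ 0 → (∀ t < θ, ∀ x, Real.sqrt (-t) * ‖u t x‖ ≤ ε₀) → ∀ t < θ, ∀ x, u t x = 0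

/-- **Translation leaf** (`A = 0`; tree theorem `KNSS2009_typeI_rate_liouville_holds` after
"directional derivative zero ⇒ invariant along the line", a rotation and a time shift; S–M). -/
def TranslationEndLiouville : Prop :=
  ∀ (C : ℝ) (u : ℝ → E3 → E3), IsTypeIAncientMild C u →
    ∀ (a : E3) (θ : ℝ), a ≠ 0 → θ ≤ 0 → (∀ t < θ, ∀ x, fderiv ℝ (u t) x a = 0) →
      ∀ t < θ, ∀ x, u t x = 0

/-- **Glue of card `columnar-mean-gap` (proved, pure logic)**: the translation leaf (tree), the
sub-Type-I decay of helical elements, the Kato gap on an end and forward uniqueness conclude the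
crux `HelicalEndLiouville` by name. -/
theorem helicalEndLiouville_of_subTypeI (hT : TranslationEndLiouville)
    (hD : HelicalAmplitudeIsSubTypeI) (hG : KatoGapOnEnd) (hB : BackwardEndVanishing) :
    HelicalEndLiouville := by
  intro C u hu a A θ hA ha hθ hsym t ht x
  by_cases hA0 : A = 0
  · subst hA0
    have ha0 : a ≠ 0 := by
      intro h
      apply ha
      exact ⟨0, by simp [h]⟩
    refine hT C u hu a θ ha0 hθ ?_ t ht x
    intro s hs y
    simpa using hsym s hs y
  · obtain ⟨ε₀, hε₀, hgap⟩ := hG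
    obtain ⟨θ', hθ'θ, hsmall⟩ := hD C u hu a A θ hA hA0 ha hθ hsym ε₀ hε₀
    have hθ'0 : θ' ≤ 0 := hθ'θ.trans hθ
    have hz : ∀ s < θ', ∀ y, u s y = 0 := hgap C u hu θ' hθ'0 hsmall
    exact hB C u hu θ' hθ'0 hz t (lt_of_lt_of_le ht hθ) x

end Summit.NavierStokesRegularity.NavierStokesRegularity.Cruxes.HelicalEndLiouville.Ideator1

end
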